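import Literature.MathematicalPhysics.QuantumManyBody.GroundStateFeynmanKacPositivity
import HarnessLib

/-!
# Crux `GroundStateRigidity` (stmt-AtomisticToContinuum-9072), line `Sketch`:
# the registered stub `stub_localTube`

Supports (does not close) stmt-AtomisticToContinuum-9072; stub `stub_localTube` of line Sketch
(lead c2). **An `n`-uniform local tube lower bound for `(e^{-H(w)} 1_A)(Y)`**: for `Y, X⋆` in the
open box with the segment `[Y, X⋆]` free of collisions and a measurable `A` charging every
coordinate box around `X⋆`, there is `r > 0` (half the clearance of the segment) such that for
every `C` some `c > 0` has `(e^{-H(w)} 1_A)(Y) ≥ c` for EVERY measurable `w` with `w ≤ C` on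
`[r, ∞)`. Local variants of the tube machinery of `GroundStateFeynmanKacPositivity.lean`
(Chung–Zhao (1995), Thm 2.4, localised to a tube): the weight bound from a LOCAL action bound,
comparison with the FREE killed functional of a translated small box, the tube bound with the
interaction bounded on the tube only, and the assembly through the semigroup law
(`fkReal_add_time`) with positivity improving / strong Feller of the free functional
(`fkReal_pos_of_nonneg`, `continuousAt_fkReal` at `v = 0`) and translation invariance.
-/

noncomputable section

open MeasureTheory Filter Set Metric
open scoped ENNReal NNReal Topology

namespace Summit.AtomisticToContinuum.BoseEinsteinCondensation.Theorems.GroundStateRigidity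

open Literature.MathematicalPhysics.QuantumManyBody.BoseGas
open Literature.Probability.Process

namespace LocalTube

variable {N : ℕ}

/-! ### Clearance of a collision-free segment and local control of the interaction -/

/-- **Clearance of a collision-free segment.** If no pair difference vanishes along the segment
`θ ↦ (1 - θ) Y + θ X⋆`, `θ ∈ [0, 1]`, there is `m > 0` such that every configuration within
coordinate distance `m / 8` of a point of the segment has all pair distances `≥ m / 2`
(minimum of a positive continuous function on the compact `[0, 1]`, finitely many pairs,
`√3 ≤ 2`). [folklore] -/
theorem exists_clearance {Y Xs : Config N}
    (hseg : ∀ θ : ℝ, θ ∈ Set.Icc (0 : ℝ) 1 → ∀ i j : Fin N, i ≠ j →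
      (1 - θ) • (Y i - Y j) + θ • (Xs i - Xs j) ≠ 0) :
    ∃ m : ℝ, 0 < m ∧ ∀ θ : ℝ, θ ∈ Set.Icc (0 : ℝ) 1 → ∀ W : Config N,
      (∀ i k, |W i k - ((1 - θ) * Y i k + θ * Xs i k)| ≤ m / 8) →
        ∀ i j : Fin N, i ≠ j → m / 2 ≤ dist (W i) (W j) := by
  -- per pair: a positive minimum of the norm of the pair difference along the segment
  have hpair : ∀ i j : Fin N, ∃ mp : ℝ, 0 < mp ∧ (i ≠ j → ∀ θ : ℝ, θ ∈ Set.Icc (0 : ℝ) 1 →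
      mp ≤ ‖(1 - θ) • (Y i - Y j) + θ • (Xs i - Xs j)‖) := by
    intro i j
    by_cases hij : i = j
    · exact ⟨1, one_pos, fun h => absurd hij h⟩
    · have hfc : Continuous fun θ : ℝ => ‖(1 - θ) • (Y i - Y j) + θ • (Xs i - Xs j)‖ :=
        (((continuous_const.sub continuous_id).smul continuous_const).add
          (continuous_id.smul continuous_const)).norm
      obtain ⟨θ₀, hθ₀, hmin⟩ := isCompact_Icc.exists_isMinOn (Set.nonempty_Icc.2 zero_le_one)
        hfc.continuousOn
      exact ⟨_, norm_pos_iff.2 (hseg θ₀ hθ₀ i j hij), fun _ θ hθ => (isMinOn_iff.1 hmin) θ hθ⟩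
  choose mp hmp0 hmp using hpair
  obtain ⟨m, hm0, hmle⟩ : ∃ m : ℝ, 0 < m ∧ ∀ i j : Fin N, m ≤ mp i j := by
    rcases isEmpty_or_nonempty (Fin N × Fin N) with hι | hι
    · exact ⟨1, one_pos, fun i j => hι.elim (i, j)⟩
    · obtain ⟨p, hp⟩ := Finite.exists_min fun p : Fin N × Fin N => mp p.1 p.2
      exact ⟨_, hmp0 p.1 p.2, fun i j => hp (i, j)⟩
  have h32 : Real.sqrt 3 ≤ 2 := (Real.sqrt_le_left (by norm_num)).2 (by norm_num)
  refine ⟨m, hm0, fun θ hθ W hW i j hij => ?_⟩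
  set P : Config N := fun i => (1 - θ) • Y i + θ • Xs i with hP
  have hPik : ∀ i' k', P i' k' = (1 - θ) * Y i' k' + θ * Xs i' k' := by
    intro i' k'
    simp [hP]
  have hWP : dist W P ≤ Real.sqrt 3 * (m / 8) :=
    dist_le_of_abs_coord_le (by positivity) fun i' k' => by rw [hPik]; exact hW i' k'
  have hPij : m ≤ dist (P i) (P j) := by
    rw [dist_eq_norm]
    have hdiff : P i - P j = (1 - θ) • (Y i - Y j) + θ • (Xs i - Xs j) := by
      simp only [hP, smul_sub]
      abel
    rw [hdiff]
    exact (hmle i j).trans (hmp i j hij θ hθ)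
  linarith [dist_le_pi_dist W P i, dist_le_pi_dist W P j, dist_triangle4 (P i) (W i) (W j) (P j),
    dist_comm (P i) (W i), mul_le_mul_of_nonneg_right h32 (by positivity : (0 : ℝ) ≤ m / 8)]

/-- If all pair distances of `W` are `≥ r` and `w ≤ C` on `[r, ∞)`, the interaction of `W` is at
most `N² C` (only the values of `w` at the distances that occur are used). [folklore] -/
theorem interaction_le_of_far {w : ℝ → ℝ≥0∞} {C : ℝ≥0} {r : ℝ} (hwC : ∀ s : ℝ, r ≤ s → w s ≤ C)
    {W : Config N} (hfar : ∀ i j : Fin N, i ≠ j → r ≤ dist (W i) (W j)) :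
    interaction w W ≤ (N * N : ℕ) * C := by
  unfold interaction
  calc ∑ i : Fin N, ∑ j ∈ Finset.univ.filter (fun j => i < j), w (dist (W i) (W j))
      ≤ ∑ _i : Fin N, ∑ _j : Fin N, (C : ℝ≥0∞) := by
        refine Finset.sum_le_sum fun i _ => ?_
        refine (Finset.sum_le_sum fun j hj =>
          hwC _ (hfar i j (Finset.mem_filter.1 hj).2.ne)).trans ?_
        exact Finset.sum_le_sum_of_subset_of_nonneg (Finset.filter_subset _ _) fun _ _ _ => bot_le
    _ = (N * N : ℕ) * C := by
        simp only [Finset.sum_const, Finset.card_univ, Fintype.card_fin, Nat.cast_mul, nsmul_eq_mul]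
        ring

/-- **Weight lower bound from a LOCAL action bound**: a path surviving in `Λ_L^N` up to time
`t ≥ 0` whose interaction is `≤ N² C` at all times in `(0, t]` has weight `w_t ≥ e^{-N²Ct}`.
[folklore] -/
theorem exp_le_toReal_fkWeight {v : ℝ → ℝ≥0∞} {C : ℝ≥0} {L t : ℝ} (ht : 0 ≤ t) {X : Config N}
    {ω : PathSpace N} (hsurv : ω ∈ survives L t X)
    (hint : ∀ u ∈ Set.Ioc (0 : ℝ) t, interaction v (worldLine X ω u.toNNReal) ≤ (N * N : ℕ) * C) :
    Real.exp (-((N * N : ℕ) * C * t)) ≤ (fkWeight v L t X ω).toReal := by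
  rw [fkWeight, Set.indicator_of_mem hsurv]
  have hA : pathAction v t X ω ≤ (N * N : ℕ) * (C : ℝ≥0∞) * ENNReal.ofReal t := by
    unfold pathAction
    calc ∫⁻ u in Set.Ioc (0 : ℝ) t, interaction v (worldLine X ω u.toNNReal)
        ≤ ∫⁻ _u in Set.Ioc (0 : ℝ) t, ((N * N : ℕ) : ℝ≥0∞) * C :=
          setLIntegral_mono measurable_const hint
      _ = (N * N : ℕ) * (C : ℝ≥0∞) * ENNReal.ofReal t := by
          rw [setLIntegral_const, Real.volume_Ioc, sub_zero]
  have hM : ((N * N : ℕ) * (C : ℝ≥0∞) * ENNReal.ofReal t) ≠ ⊤ :=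
    ENNReal.mul_ne_top (ENNReal.mul_ne_top (ENNReal.natCast_ne_top _) ENNReal.coe_ne_top)
      ENNReal.ofReal_ne_top
  have hmono : (expNeg ((N * N : ℕ) * (C : ℝ≥0∞) * ENNReal.ofReal t)).toReal ≤
      (expNeg (pathAction v t X ω)).toReal :=
    ENNReal.toReal_mono ((expNeg_le_one _).trans_lt ENNReal.one_lt_top).ne (expNeg_antitone hA)
  refine le_trans (le_of_eq ?_) hmono
  rw [expNeg, if_neg hM, ENNReal.toReal_ofReal (Real.exp_pos _).le]
  congr 1
  rw [ENNReal.toReal_mul, ENNReal.toReal_mul, ENNReal.toReal_ofReal ht]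
  simp

/-! ### Comparison with the free killed functional of a translated small box -/

/-- Membership in the translated small box: with `Z₀ = X⋆ - (ℓ, …, ℓ)`,
`W - Z₀ ∈ Λ_{2ℓ}^N` iff `W` is within coordinate distance `< ℓ` of `X⋆`. [folklore] -/
theorem sub_mem_boxN_iff {Xs Z₀ : Config N} {ℓ : ℝ} (hZ₀ : ∀ i k, Z₀ i k = Xs i k - ℓ)
    (W : Config N) : W - Z₀ ∈ boxN N (2 * ℓ) ↔ ∀ i k, |W i k - Xs i k| < ℓ := by
  simp only [boxN, box, Set.mem_setOf_eq, Pi.sub_apply, PiLp.sub_apply, hZ₀, Set.mem_Ioo]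
  refine forall_congr' fun i => forall_congr' fun k => ?_
  rw [abs_lt]
  constructor <;> intro h <;> constructor <;> linarith [h.1, h.2]

/-- A (pre-composed) indicator observable has finite squared `L²` mass on every box. [folklore] -/
theorem setLIntegral_indicator_sq_ne_top (A : Set (Config N)) (L : ℝ) (φ : Config N → Config N) :
    ∫⁻ W in boxN N L, ‖A.indicator (fun _ => (1 : ℝ)) (φ W)‖ₑ ^ (2 : ℝ) ≠ ⊤ := by
  refine ne_top_of_le_ne_top (volume_boxN_lt_top N L).ne ?_
  calc ∫⁻ W in boxN N L, ‖A.indicator (fun _ => (1 : ℝ)) (φ W)‖ₑ ^ (2 : ℝ)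
      ≤ ∫⁻ _W in boxN N L, 1 := lintegral_mono fun W =>
        ENNReal.rpow_le_one (by by_cases hW : φ W ∈ A <;> simp [hW]) (by norm_num)
    _ = volume (boxN N L) := by rw [setLIntegral_const, one_mul]

/-- **Domain monotonicity with a local potential bound, after a translation.** Let `Z₀` be a shift
such that every `W` with `W - Z₀ ∈ Λ_{L'}^N` lies in `Λ_L^N` and has interaction `≤ N² C` for the
potential `w`. Then for `g ≥ 0` measurable and square integrable on `Λ_L^N` and `t > 0`:
`e^{-N²Ct} · (e^{-t H⁰_{Λ_{L'}}} g(· + Z₀))(Z - Z₀) ≤ (e^{-t H(w)_{Λ_L}} g)(Z)` — a path whose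
translate survives in the small box survives in the big one and picks up at most `N² C t` of
action, and the free weight is `≤ 1`. [folklore] -/
theorem exp_mul_fkReal_shift_le {w : ℝ → ℝ≥0∞} (hw : Measurable w) {C : ℝ≥0} {L L' : ℝ}
    (Z₀ : Config N)
    (hQ : ∀ W : Config N, W - Z₀ ∈ boxN N L' → W ∈ boxN N L ∧ interaction w W ≤ (N * N : ℕ) * C)
    {t : ℝ} (ht : 0 < t) {g : Config N → ℝ} (hg : Measurable g) (hg0 : ∀ W, 0 ≤ g W)
    (hg2 : ∫⁻ W in boxN N L, ‖g W‖ₑ ^ (2 : ℝ) ≠ ⊤) (Z : Config N) :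
    Real.exp (-((N * N : ℕ) * C * t)) *
        fkReal (fun _ => 0) L' t (fun W => g (W + Z₀)) (Z - Z₀) ≤ fkReal w L t g Z := by
  have hwl : ∀ (ω : PathSpace N) (s : ℝ≥0), worldLine (Z - Z₀) ω s = worldLine Z ω s - Z₀ :=
    fun ω s => by rw [worldLine_eq_add, worldLine_eq_add]; abel
  -- pathwise comparison of the integrands
  have hpt : ∀ ω : PathSpace N, Real.exp (-((N * N : ℕ) * C * t)) *
      ((fkWeight (fun _ => 0) L' t (Z - Z₀) ω).toReal *
        g (worldLine (Z - Z₀) ω t.toNNReal + Z₀)) ≤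
      (fkWeight w L t Z ω).toReal * g (worldLine Z ω t.toNNReal) := by
    intro ω
    rw [hwl, sub_add_cancel]
    have hγ := hg0 (worldLine Z ω t.toNNReal)
    by_cases hω : ω ∈ survives L' t (Z - Z₀)
    · -- local control along the surviving translated path
      have hloc : ∀ s ∈ Set.Icc (0 : ℝ) t, worldLine Z ω s.toNNReal ∈ boxN N L ∧
          interaction w (worldLine Z ω s.toNNReal) ≤ (N * N : ℕ) * C := by
        intro s hs
        refine hQ _ ?_
        rw [← hwl]
        exact hω s hs
      have hwt : Real.exp (-((N * N : ℕ) * C * t)) ≤ (fkWeight w L t Z ω).toReal :=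
        exp_le_toReal_fkWeight ht.le (fun s hs => (hloc s hs).1)
          fun u hu => (hloc u (Set.Ioc_subset_Icc_self hu)).2
      have hfree : (fkWeight (fun _ => 0) L' t (Z - Z₀) ω).toReal ≤ 1 := by
        simpa using ENNReal.toReal_mono ENNReal.one_ne_top (fkWeight_le_one _ L' t (Z - Z₀) ω)
      calc Real.exp (-((N * N : ℕ) * C * t)) *
            ((fkWeight (fun _ => 0) L' t (Z - Z₀) ω).toReal * g (worldLine Z ω t.toNNReal))
          ≤ Real.exp (-((N * N : ℕ) * C * t)) * (1 * g (worldLine Z ω t.toNNReal)) :=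
            mul_le_mul_of_nonneg_left (mul_le_mul_of_nonneg_right hfree hγ) (Real.exp_pos _).le
        _ ≤ (fkWeight w L t Z ω).toReal * g (worldLine Z ω t.toNNReal) := by
            rw [one_mul]
            exact mul_le_mul_of_nonneg_right hwt hγ
    · have h0 : fkWeight (fun _ => 0) L' t (Z - Z₀) ω = 0 := Set.indicator_of_notMem hω _
      rw [h0, ENNReal.toReal_zero, zero_mul, mul_zero]
      exact mul_nonneg ENNReal.toReal_nonneg hγ
  rw [fkReal, fkReal, ← integral_const_mul]
  exact integral_mono_of_nonneg (Eventually.of_forall fun ω => mul_nonneg (Real.exp_pos _).le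
    (mul_nonneg ENNReal.toReal_nonneg (hg0 _))) (integrable_fkIntegrand hw L ht hg hg2 Z)
    (Eventually.of_forall hpt)

/-! ### The tube lower bound with a local potential bound -/

/-- **Tube lower bound with a LOCAL potential bound.** As `fkReal_ge_of_tube`, but the global
bound `v ≤ C` is replaced by the bound `∑_{i<j} v ≤ N² C` (together with membership in the box)
for configurations within coordinate distance `ε` of the segment `[X, Y]`, which is all the tube
ever sees: for `t > 0`, `h ≥ 0` measurable and square integrable on the box with `h ≥ a ≥ 0` on
the coordinate `ε`-box around `Y`, `(e^{-tH} h)(X) ≥ e^{-N²Ct} a P(tube)`. [folklore] -/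
theorem fkReal_ge_of_localTube {v : ℝ → ℝ≥0∞} (hv : Measurable v) {C : ℝ≥0}
    {L : ℝ} {t : ℝ≥0} (ht : t ≠ 0) {X Y : Config N} {ε : ℝ}
    (hloc : ∀ (W : Config N) (θ : ℝ), θ ∈ Set.Icc (0 : ℝ) 1 →
      (∀ i k, |W i k - ((1 - θ) * X i k + θ * Y i k)| ≤ ε) →
        W ∈ boxN N L ∧ interaction v W ≤ (N * N : ℕ) * C)
    {h : Config N → ℝ} (hh : Measurable h) (hh0 : ∀ Z, 0 ≤ h Z)
    (hh2 : ∫⁻ Z in boxN N L, ‖h Z‖ₑ ^ (2 : ℝ) ≠ ⊤)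
    {a : ℝ} (ha : 0 ≤ a) (hha : ∀ Z : Config N, (∀ i k, |Z i k - Y i k| ≤ ε) → a ≤ h Z) :
    Real.exp (-((N * N : ℕ) * C * t)) * a *
        (wienerPaths N {ω | ∀ (i : Fin N) (k : Fin 3) (q : ℚ), (q : ℝ) ∈ Set.Icc (0 : ℝ) t →
          |brownian (q : ℝ).toNNReal (ω i k) - ((q : ℝ) / t) * ((Y i k - X i k) / Real.sqrt 2)| ≤
            ε / Real.sqrt 2}).toReal ≤
      fkReal v L t h X := by
  set E : Set (PathSpace N) := {ω | ∀ (i : Fin N) (k : Fin 3) (q : ℚ), (q : ℝ) ∈ Set.Icc (0 : ℝ) t →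
    |brownian (q : ℝ).toNNReal (ω i k) - ((q : ℝ) / t) * ((Y i k - X i k) / Real.sqrt 2)| ≤
      ε / Real.sqrt 2} with hE
  have ht0 : (0 : ℝ) < t := by exact_mod_cast pos_iff_ne_zero.2 ht
  -- on the tube: in the box, with controlled interaction, at all times `s ≤ t`
  have htube : ∀ ω ∈ E, ∀ s : ℝ≥0, s ≤ t → worldLine X ω s ∈ boxN N L ∧
      interaction v (worldLine X ω s) ≤ (N * N : ℕ) * C := by
    intro ω hω s hs
    refine hloc _ (s / t) ⟨by positivity, ?_⟩ fun i k => abs_worldLine_sub_line_le ht hω i k hs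
    rw [div_le_one ht0]
    exact_mod_cast hs
  have hend : ∀ ω ∈ E, a ≤ h (worldLine X ω t) := by
    intro ω hω
    refine hha _ fun i k => ?_
    have h1 := abs_worldLine_sub_line_le (Y := Y) ht hω i k (le_refl t)
    rwa [div_self ht0.ne', sub_self, zero_mul, zero_add, one_mul] at h1
  have hw : ∀ ω ∈ E, Real.exp (-((N * N : ℕ) * C * t)) ≤ (fkWeight v L t X ω).toReal :=
    fun ω hω => exp_le_toReal_fkWeight t.coe_nonneg
      (fun s hs => (htube ω hω s.toNNReal (Real.toNNReal_le_iff_le_coe.2 hs.2)).1)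
      fun u hu => (htube ω hω u.toNNReal (Real.toNNReal_le_iff_le_coe.2 hu.2)).2
  -- integrate the indicator of the tube event from below
  have hmeas : MeasurableSet E := measurableSet_ratTube t _ _
  have hint : Integrable (fun ω : PathSpace N =>
      (fkWeight v L t X ω).toReal * h (worldLine X ω t)) (wienerPaths N) := by
    simpa only [Real.toNNReal_coe] using integrable_fkIntegrand hv L ht0 hh hh2 X
  calc Real.exp (-((N * N : ℕ) * C * t)) * a * (wienerPaths N E).toReal
      = ∫ ω, E.indicator (fun _ => Real.exp (-((N * N : ℕ) * C * t)) * a) ω ∂wienerPaths N := by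
        rw [integral_indicator_const _ hmeas, smul_eq_mul, mul_comm, measureReal_def]
    _ ≤ ∫ ω, (fkWeight v L t X ω).toReal * h (worldLine X ω t) ∂wienerPaths N := by
        refine integral_mono_of_nonneg (Eventually.of_forall fun ω => ?_) hint
          (Eventually.of_forall fun ω => ?_)
        · exact Set.indicator_nonneg (fun _ _ => by positivity) _
        · by_cases hω : ω ∈ E
          · rw [Set.indicator_of_mem hω]
            exact mul_le_mul (hw ω hω) (hend ω hω) ha ENNReal.toReal_nonneg
          · rw [Set.indicator_of_notMem hω]
            exact mul_nonneg ENNReal.toReal_nonneg (hh0 _)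
    _ = fkReal v L t h X := by rw [fkReal, Real.toNNReal_coe]

end LocalTube

open LocalTube in
/-- **Stub `stub_localTube` — an `n`-uniform local tube lower bound for `e^{-H} 1_A`.** Let `Y, X⋆`
lie in the open box with the segment `[Y, X⋆]` free of collisions, and let the measurable set `A`
charge every coordinate box around `X⋆`. Then there is `r > 0` such that for every bound `C` some
`c > 0` has `(e^{-H(w)} 1_A)(Y) ≥ c` for EVERY measurable `w` with `w ≤ C` on `[r, ∞)` (whatever `w`
does below `r`): `r` is half the clearance (`exists_clearance`); semigroup law
`e^{-H} = e^{-H/2} e^{-H/2}` (`fkReal_add_time`); `h = e^{-H(w)/2} 1_A ≥ e^{-N²C/2} · (FREE killed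
functional of the small coordinate box `Q` around `X⋆`)(1_A) ≥ a > 0` near `X⋆` uniformly in `w`
(`exp_mul_fkReal_shift_le`, `fkReal_pos_of_nonneg` and `continuousAt_fkReal` with `v = 0`, `A`
charges `Q`, translation invariance of Lebesgue measure); then the tube bound along `[Y, X⋆]` with
the interaction bounded ON THE TUBE only (`fkReal_ge_of_localTube`, `measure_ratTube_pos`,
`exists_margin_segment`). Chung–Zhao (1995), Thm 2.4, localised. [cite: ChungZhao1995, Thm 2.4] -/
theorem stub_localTube :
    ∀ (N : ℕ) (L : ℝ) (Y Xs : Config N), 0 < L → Y ∈ boxN N L → Xs ∈ boxN N L →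
      (∀ θ : ℝ, θ ∈ Set.Icc (0 : ℝ) 1 → ∀ i j : Fin N, i ≠ j →
        (1 - θ) • (Y i - Y j) + θ • (Xs i - Xs j) ≠ 0) →
      ∀ A : Set (Config N), MeasurableSet A →
      (∀ δ : ℝ, 0 < δ → 0 < volume (A ∩ {Z : Config N | ∀ i k, |Z i k - Xs i k| < δ})) →
      ∃ r : ℝ, 0 < r ∧ ∀ C : ℝ≥0, ∃ c : ℝ, 0 < c ∧ ∀ w : ℝ → ℝ≥0∞, Measurable w →
        (∀ s : ℝ, r ≤ s → w s ≤ C) → c ≤ fkReal w L 1 (A.indicator fun _ => (1 : ℝ)) Y := by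
  intro N L Y Xs _hL hY hXs hseg A hA hAvol
  -- (0) clearance of the segment: `r = m / 2`
  obtain ⟨m, hm, hclear⟩ := exists_clearance hseg
  refine ⟨m / 2, by positivity, fun C => ?_⟩
  set g : Config N → ℝ := A.indicator fun _ => (1 : ℝ) with hg
  have hgm : Measurable g := measurable_const.indicator hA
  have hg0 : ∀ W, 0 ≤ g W := fun W => Set.indicator_nonneg (fun _ _ => zero_le_one) W
  have hg2 : ∫⁻ W in boxN N L, ‖g W‖ₑ ^ (2 : ℝ) ≠ ⊤ := setLIntegral_indicator_sq_ne_top A L id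
  -- the small coordinate box `Q` of half-width `ℓ` around `X⋆` and its corner `Z₀`
  obtain ⟨μ, hμ, hμbox⟩ := exists_margin_segment hXs hXs
  set ℓ : ℝ := min μ (m / 8)
  have hℓ0 : 0 < ℓ := lt_min hμ (by positivity)
  set Z₀ : Config N := fun i => Xs i - WithLp.toLp 2 (fun _ : Fin 3 => ℓ) with hZ₀def
  have hZ₀ : ∀ i k, Z₀ i k = Xs i k - ℓ := by
    intro i k
    simp [hZ₀def]
  -- `Q ⊆ Λ_L^N` and all pairs in `Q` are `≥ r`: the interaction is `≤ N² C`, uniformly in `w`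
  have hQ : ∀ w : ℝ → ℝ≥0∞, (∀ s : ℝ, m / 2 ≤ s → w s ≤ C) → ∀ W : Config N,
      W - Z₀ ∈ boxN N (2 * ℓ) → W ∈ boxN N L ∧ interaction w W ≤ (N * N : ℕ) * C := by
    intro w hwC W hW
    have hco := (sub_mem_boxN_iff hZ₀ W).1 hW
    refine ⟨hμbox W 0 ⟨le_rfl, zero_le_one⟩ fun i k => ?_,
      interaction_le_of_far hwC (hclear 1 ⟨zero_le_one, le_rfl⟩ W fun i k => ?_)⟩
    · rw [show (1 - (0 : ℝ)) * Xs i k + 0 * Xs i k = Xs i k by ring]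
      exact (hco i k).le.trans (min_le_left _ _)
    · rw [show (1 - (1 : ℝ)) * Y i k + 1 * Xs i k = Xs i k by ring]
      exact (hco i k).le.trans (min_le_right _ _)
  -- the FREE killed functional of the translated observable in the standard box `Λ_{2ℓ}^N`
  set g' : Config N → ℝ := fun W => g (W + Z₀) with hg'
  have hg'm : Measurable g' := hgm.comp (measurable_add_const Z₀)
  have hg'2 : ∫⁻ W in boxN N (2 * ℓ), ‖g' W‖ₑ ^ (2 : ℝ) ≠ ⊤ :=
    setLIntegral_indicator_sq_ne_top A _ fun W => W + Z₀
  have hC0 : ∀ s : ℝ, (fun _ : ℝ => (0 : ℝ≥0∞)) s ≤ ((0 : ℝ≥0) : ℝ≥0∞) := fun _ => bot_le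
  set F : Config N → ℝ := fkReal (fun _ : ℝ => (0 : ℝ≥0∞)) (2 * ℓ) (1 / 2) g'
  have hctr_mem : Xs - Z₀ ∈ boxN N (2 * ℓ) := fun i k => by
    rw [show (Xs - Z₀) i k = ℓ by simp only [Pi.sub_apply, PiLp.sub_apply, hZ₀, sub_sub_cancel]]
    exact ⟨hℓ0, by linarith⟩
  -- `g'` is not a.e. zero on the standard box: `A` charges `Q`, translation invariance
  have hne : ¬ g' =ᵐ[volume.restrict (boxN N (2 * ℓ))] 0 := by
    intro h0
    set S : Set (Config N) :=
      (fun W => W + Z₀) ⁻¹' (A ∩ {Z : Config N | ∀ i k, |Z i k - Xs i k| < ℓ}) with hS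
    have hS1 : S ⊆ {W | ¬ g' W = (0 : Config N → ℝ) W} := by
      intro W hW
      have hWA : W + Z₀ ∈ A := hW.1
      simp [hg', hg, hWA]
    have hS2 : S ⊆ boxN N (2 * ℓ) := by
      rintro W ⟨-, hWQ⟩
      have := (sub_mem_boxN_iff hZ₀ (W + Z₀)).2 hWQ
      rwa [add_sub_cancel_right] at this
    have h1 : volume.restrict (boxN N (2 * ℓ)) S = 0 := measure_mono_null hS1 (ae_iff.1 h0)
    rw [Measure.restrict_apply' (measurableSet_boxN N (2 * ℓ)), Set.inter_eq_left.2 hS2, hS,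
      measure_preimage_add_right] at h1
    exact (hAvol ℓ hℓ0).ne' h1
  -- positivity at the centre and continuity there (the free functional: `v = 0` is bounded)
  have hFpos : 0 < F (Xs - Z₀) :=
    fkReal_pos_of_nonneg measurable_const hC0 one_half_pos hg'm (fun W => hg0 _) hg'2 hne hctr_mem
  obtain ⟨δ, hδ, hδF⟩ := Metric.continuousAt_iff.1
    (continuousAt_fkReal measurable_const hC0 (2 * ℓ) one_half_pos hg'm hg'2 hctr_mem)
    (F (Xs - Z₀) / 2) (half_pos hFpos)
  have h32 : Real.sqrt 3 ≤ 2 := (Real.sqrt_le_left (by norm_num)).2 (by norm_num)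
  have hFge : ∀ Z : Config N, (∀ i k, |Z i k - Xs i k| ≤ δ / 4) →
      F (Xs - Z₀) / 2 ≤ F (Z - Z₀) := by
    intro Z hZ
    have hd : dist (Z - Z₀) (Xs - Z₀) < δ := by
      rw [dist_sub_right]
      have h1 := dist_le_of_abs_coord_le (by positivity) hZ
      linarith [mul_le_mul_of_nonneg_right h32 (by positivity : (0 : ℝ) ≤ δ / 4)]
    have hdist := hδF hd
    rw [Real.dist_eq, abs_sub_lt_iff] at hdist
    linarith [hdist.1, hdist.2]
  -- tube data (independent of `w`)
  obtain ⟨εm, hεm, hmarginY⟩ := exists_margin_segment hY hXs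
  set ε : ℝ := min εm (min (m / 8) (δ / 4))
  have hε0 : 0 < ε := lt_min hεm (lt_min (by positivity) (by positivity))
  set t : ℝ≥0 := (1 / 2 : ℝ).toNNReal with htdef
  have ht0 : t ≠ 0 := by
    rw [htdef]
    exact fun h0 => absurd (Real.toNNReal_eq_zero.1 h0) (not_le.2 one_half_pos)
  have htc : (t : ℝ) = 1 / 2 := Real.coe_toNNReal _ one_half_pos.le
  set E : Set (PathSpace N) := {ω | ∀ (i : Fin N) (k : Fin 3) (q : ℚ), (q : ℝ) ∈ Set.Icc (0 : ℝ) t →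
    |brownian (q : ℝ).toNNReal (ω i k) - ((q : ℝ) / t) * ((Xs i k - Y i k) / Real.sqrt 2)| ≤
      ε / Real.sqrt 2}
  have hPE : 0 < wienerPaths N E :=
    measure_ratTube_pos t ht0 (fun i k => (Xs i k - Y i k) / Real.sqrt 2)
      (ε := ε / Real.sqrt 2) (by positivity)
  set κ : ℝ := Real.exp (-((N * N : ℕ) * C * (1 / 2 : ℝ)))
  set a : ℝ := κ * (F (Xs - Z₀) / 2)
  have ha0 : 0 < a := mul_pos (Real.exp_pos _) (half_pos hFpos)
  refine ⟨Real.exp (-((N * N : ℕ) * C * t)) * a * (wienerPaths N E).toReal,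
    mul_pos (mul_pos (Real.exp_pos _) ha0) (ENNReal.toReal_pos hPE.ne' (measure_ne_top _ _)),
    fun w hw hwC => ?_⟩
  -- (1) semigroup law: `e^{-H} g = e^{-H/2} h` with `h = e^{-H/2} g`
  set h : Config N → ℝ := fkReal w L (1 / 2) g with hh
  have hhm : Measurable h := measurable_fkReal hw L _ hgm
  have hh0 : ∀ Z, 0 ≤ h Z := fun Z => fkReal_nonneg w L _ hg0 Z
  have hh2 : ∫⁻ Z in boxN N L, ‖h Z‖ₑ ^ (2 : ℝ) ≠ ⊤ :=
    ne_top_of_le_ne_top hg2 (setLIntegral_enorm_fkReal_sq_le hw L one_half_pos.le hgm)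
  have hsemi : fkReal w L 1 g Y = fkReal w L t h Y := by
    rw [htc, hh, ← fkReal_add_time hw L one_half_pos one_half_pos hgm hg2 Y, add_halves]
  -- (2) `h ≥ a` on the coordinate `ε`-box around `X⋆`, uniformly in `w`
  have hha : ∀ Z : Config N, (∀ i k, |Z i k - Xs i k| ≤ ε) → a ≤ h Z := by
    intro Z hZ
    calc a ≤ κ * F (Z - Z₀) :=
          mul_le_mul_of_nonneg_left (hFge Z fun i k =>
            (hZ i k).trans ((min_le_right _ _).trans (min_le_right _ _))) (Real.exp_pos _).le
      _ ≤ h Z := exp_mul_fkReal_shift_le hw Z₀ (hQ w hwC) one_half_pos hgm hg0 hg2 Z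
  -- (3) the tube from `Y` to `X⋆`
  have hloc : ∀ (W : Config N) (θ : ℝ), θ ∈ Set.Icc (0 : ℝ) 1 →
      (∀ i k, |W i k - ((1 - θ) * Y i k + θ * Xs i k)| ≤ ε) →
        W ∈ boxN N L ∧ interaction w W ≤ (N * N : ℕ) * C := fun W θ hθ hW =>
    ⟨hmarginY W θ hθ fun i k => (hW i k).trans (min_le_left _ _),
      interaction_le_of_far hwC (hclear θ hθ W fun i k =>
        (hW i k).trans ((min_le_right _ _).trans (min_le_left _ _)))⟩
  rw [hsemi]
  exact fkReal_ge_of_localTube hw ht0 hloc hhm hh0 hh2 ha0.le hha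

end Summit.AtomisticToContinuum.BoseEinsteinCondensation.Theorems.GroundStateRigidity

end
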